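import Literature.NumberTheory.Automorphic.GLnPlacesSplittingOperators
import Literature.NumberTheory.Automorphic.ProductGroupConvolution
import Mathlib.MeasureTheory.Integral.Pi
import HarnessLib

/-!
# The `*`-algebra of test functions `ξ_S ⊗ f` with a fixed ramified factor: convolution,
# involution and translations of the product test functions `Ξ ⊗ θ` on `GL_n(𝔸_K) = G_S × G^S`
(Gelbart, *Automorphic forms on adele groups* (1975), §10, p. 153: `Φ_f = ξ_S ⊗ f`,
`ξ_S = ⊗_{v ∈ S} f_v` normalised matrix coefficients — idempotents, (10.11) — and `f ∈ C_c^∞(G^S)`;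
(10.12)–(10.13): `Φ_f ⋆ Φ_f^* = ξ_S ⊗ (f ⋆ f^*)`; Deitmar–Echterhoff (2014), §1.6)

Topic `NumberTheory/Automorphic`; theorems only (no definition, no named fact, no instance
visible to importers). For the product test functions `Φ_{Ξ,θ}(g) = θ(s_S g) Ξ(g_S)`
(`GLn.placesTestFunction`, `GLnPlacesSplittingOperators`) along the splitting
`GLn.placesSplitting n K S : G_S × G^S ≃ₜ* GL_n(𝔸_K)` with `(splitting⁻¹)_* ν = κ ((⊗_v μ_v) ⊗ μ')`:

* `mulConv_placesTestFunction` — **`(Ξ₁ ⊗ θ₁) ⋆_ν (Ξ₂ ⊗ θ₂) (ι_S(a) h) =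
  κ · (Ξ₁ ⋆ Ξ₂)(a) · (θ₁| ⋆_{μ'} θ₂|)(h)`** (`mulConv_tensor` and the change of variables along the
  splitting, `ProductGroupConvolution`);
* `mulStar_placesTestFunction` — `(Ξ ⊗ θ)^*(ι_S(a) h) = \overline{θ(h⁻¹)} · Ξ^*(a)`;
* `mulConv_tensorPi`, `mulStar_tensorPi` — on `G_S = ∏_{v ∈ S} GL_n(K_v)` with `⊗_v μ_v`:
  **`(⊗ ξ_v) ⋆ (⊗ ξ'_v) = ⊗ (ξ_v ⋆ ξ'_v)`** (Fubini over the finite product,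
  `MeasureTheory.integral_fintype_prod_eq_prod`) and `(⊗ ξ_v)^* = ⊗ ξ_v^*`; hence
  `mulConv_tensorPi_of_idempotent`: local idempotents `ξ_v ⋆ ξ_v = c_v ξ_v` give
  `Ξ ⋆ Ξ = (∏ c_v) Ξ` for `Ξ = ⊗ ξ_v`, and `mulStar_tensorPi_of_selfAdjoint`;
* `placesTestFunction_toAdelic_inv_mul` — **translations at `w ∉ S` act on the `G^S`-factor**:
  `Φ_{Ξ,θ}(ι_w(l)⁻¹ g) = Φ_{Ξ, θ(ι_w(l)⁻¹ ·)}(g)` (`ι_w(l) ∈ G^S` commutes with `ι_S(G_S)`);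
* `exists_placesTestFunction_extension` — every `F ∈ C_c(G^S)` is the restriction of a
  `θ ∈ C_c(GL_n(𝔸_K))` (so the `G^S`-factors may be prescribed on `G^S`).

So for a fixed `Ξ` with `Ξ ⋆ Ξ = c Ξ` (`c ≠ 0`) and `Ξ^* = Ξ` the functions `Φ_{Ξ,θ}`, `θ|_{G^S}`
ranging over `C_c(G^S)`, span a `*`-subalgebra of `(C_c(GL_n(𝔸_K)), ⋆_ν, *)` stable under the left
translations by `ι_w(GL_n(K_w))`, `w ∉ S` — the `GL`-components of the matched algebra `𝒜` of
`exists_discreteAutomorphicRep_of_ramifiedFactor` (Gelbart's `{ξ_S ⊗ f}`). Part of the inline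
(D-0026) decomposition of
`Literature.NumberTheory.Automorphic.jacquetLanglands_transfer_surjective` (Gelbart Thm. 10.5 (ii)).

## References

* S. Gelbart, *Automorphic forms on adele groups*, Ann. of Math. Studies 83 (1975), §10, p. 153,
  (10.11)–(10.13) [Gelbart1975].
* A. Deitmar, S. Echterhoff, *Principles of harmonic analysis*, 2nd ed. (2014), §1.6, Prop. 6.2.1
  [DeitmarEchterhoff2014].
-/

noncomputable section

open MeasureTheory Measure Set Filter Topology IsDedekindDomain NumberField CompactlySupported
open scoped ENNReal NNReal ComplexConjugate

namespace Literature.NumberTheory.Automorphic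

/-! ### Tensors on a finite product of groups -/

section TensorPi

variable {ι : Type*} [Fintype ι] {L : ι → Type*} [∀ i, Group (L i)]

/-- **`(⊗ ξ_i)^* = ⊗ ξ_i^*`** on a product of groups. [folklore] -/
theorem mulStar_tensorPi (ξ : ∀ i, L i → ℂ) :
    mulStar (fun x : (∀ i, L i) => ∏ i, ξ i (x i)) = fun x => ∏ i, mulStar (ξ i) (x i) := by
  funext x
  simp only [mulStar_apply, Pi.inv_apply, map_prod]

variable [∀ i, MeasurableSpace (L i)]

/-- **`(⊗ ξ_i) ⋆ (⊗ ξ'_i) = ⊗ (ξ_i ⋆ ξ'_i)`** for the product measure `⊗ μ_i`: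
`∫ ∏ ξ_i(y_i) ξ'_i(y_i⁻¹ x_i) d(⊗ μ_i)(y) = ∏ ∫ ξ_i(y) ξ'_i(y⁻¹ x_i) dμ_i(y)` (Fubini on the finite
product, `MeasureTheory.integral_fintype_prod_eq_prod`; no integrability needed).
[cite: DeitmarEchterhoff2014, §1.6] -/
theorem mulConv_tensorPi (μ : ∀ i, Measure (L i)) [∀ i, SigmaFinite (μ i)]
    (ξ ξ' : ∀ i, L i → ℂ) (x : ∀ i, L i) :
    mulConv (Measure.pi μ) (fun y : (∀ i, L i) => ∏ i, ξ i (y i)) (fun y => ∏ i, ξ' i (y i)) x =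
      ∏ i, mulConv (μ i) (ξ i) (ξ' i) (x i) := by
  rw [mulConv_apply]
  simp_rw [mulConv_apply]
  rw [← integral_fintype_prod_eq_prod (fun i y => ξ i y * ξ' i (y⁻¹ * x i))]
  refine integral_congr_ae (Eventually.of_forall fun y => ?_)
  change (∏ i, ξ i (y i)) * ∏ i, ξ' i ((y⁻¹ * x) i) = ∏ i, ξ i (y i) * ξ' i ((y i)⁻¹ * x i)
  rw [← Finset.prod_mul_distrib]
  rfl

/-- Local idempotents give a global one: if `ξ_i ⋆ ξ_i = c_i ξ_i` for all `i` then
`(⊗ ξ_i) ⋆ (⊗ ξ_i) = (∏ c_i) (⊗ ξ_i)` (Gelbart (1975), (10.11): `ξ_S = ⊗ f_v` with idempotent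
normalised matrix coefficients `f_v`). [cite: Gelbart1975, (10.11)] -/
theorem mulConv_tensorPi_of_idempotent (μ : ∀ i, Measure (L i)) [∀ i, SigmaFinite (μ i)]
    (ξ : ∀ i, L i → ℂ) (c : ι → ℂ) (h : ∀ i y, mulConv (μ i) (ξ i) (ξ i) y = c i * ξ i y)
    (x : ∀ i, L i) :
    mulConv (Measure.pi μ) (fun y : (∀ i, L i) => ∏ i, ξ i (y i)) (fun y => ∏ i, ξ i (y i)) x =
      (∏ i, c i) * ∏ i, ξ i (x i) := by
  rw [mulConv_tensorPi, ← Finset.prod_mul_distrib]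
  exact Finset.prod_congr rfl fun i _ => h i (x i)

omit [∀ i, MeasurableSpace (L i)] in
/-- Local self-adjointness gives a global one: if `ξ_i^* = ξ_i` for all `i` then
`(⊗ ξ_i)^* = ⊗ ξ_i`. [cite: Gelbart1975, (10.11)] -/
theorem mulStar_tensorPi_of_selfAdjoint (ξ : ∀ i, L i → ℂ) (h : ∀ i, mulStar (ξ i) = ξ i) :
    mulStar (fun x : (∀ i, L i) => ∏ i, ξ i (x i)) = fun x => ∏ i, ξ i (x i) := by
  rw [mulStar_tensorPi]
  funext x
  exact Finset.prod_congr rfl fun i _ => by rw [h i]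

end TensorPi

/-! ### `GL_n(𝔸_K)`: convolution, involution and translations of `Ξ ⊗ θ` -/

section GLn

variable {n : ℕ} {K : Type} [Field K] [NumberField K] {S : Finset (HeightOneSpectrum (𝓞 K))}

attribute [local instance] adelicBorel borelSpace_adelic locallyCompactSpace_adelic
  secondCountableTopology_gl_adelic

/-- **Convolution of product test functions on `GL_n(𝔸_K)`**: with
`(splitting⁻¹)_* ν = κ ((⊗_v μ_v) ⊗ μ')`,
`(Ξ₁ ⊗ θ₁) ⋆_ν (Ξ₂ ⊗ θ₂) (ι_S(a) h) = κ · (Ξ₁ ⋆ Ξ₂)(a) · (θ₁| ⋆_{μ'} θ₂|)(h)`, `θ_i|` the restrictions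
to `G^S` (Gelbart (1975), (10.12)–(10.13): `Φ_f ⋆ Φ_f^* = ξ_S ⊗ (f ⋆ f^*)` for idempotent `ξ_S`).
[cite: Gelbart1975, §10 p. 153, (10.12)–(10.13)] -/
theorem mulConv_placesTestFunction
    [∀ v : HeightOneSpectrum (𝓞 K), MeasurableSpace (GL (Fin n) (v.adicCompletion K))]
    [∀ v : HeightOneSpectrum (𝓞 K), BorelSpace (GL (Fin n) (v.adicCompletion K))]
    [∀ v : HeightOneSpectrum (𝓞 K), SecondCountableTopology (GL (Fin n) (v.adicCompletion K))]
    (ν : Measure (AdelicGroupData.gl n K).Adelic)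
    (μS : Measure (GLn.LocalPi n K S)) [SFinite μS]
    (μ' : Measure (GLn.trivialAt n K S)) [SFinite μ']
    {κ : ℝ≥0} (hκ : Measure.map (GLn.placesSplitting n K S).symm ν = κ • μS.prod μ')
    (Ξ₁ Ξ₂ : GLn.LocalPi n K S → ℂ) (θ₁ θ₂ : (AdelicGroupData.gl n K).Adelic → ℂ)
    (p : GLn.LocalPi n K S × GLn.trivialAt n K S) :
    mulConv ν (GLn.placesTestFunction S Ξ₁ θ₁) (GLn.placesTestFunction S Ξ₂ θ₂) (GLn.placesSplitting n K S p) =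
      (κ : ℂ) * (mulConv μS Ξ₁ Ξ₂ p.1 *
        mulConv μ' (fun h : GLn.trivialAt n K S => θ₁ (h : (AdelicGroupData.gl n K).Adelic))
          (fun h => θ₂ (h : (AdelicGroupData.gl n K).Adelic)) p.2) := by
  haveI : T2Space (AdelicGroupData.gl n K).Adelic := t2Space_gl n K
  haveI : BorelSpace (GLn.trivialAt n K S) := Subtype.borelSpace _
  haveI : SecondCountableTopology (GLn.trivialAt n K S) := TopologicalSpace.Subtype.secondCountableTopology _
  haveI : BorelSpace (GLn.LocalPi n K S) := Pi.borelSpace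
  haveI : BorelSpace (GLn.LocalPi n K S × GLn.trivialAt n K S) := Prod.borelSpace
  rw [mulConv_comp_continuousMulEquiv_of_map_eq_smul (GLn.placesSplitting n K S) ν (μS.prod μ') hκ]
  congr 1
  have h1 : (fun q => GLn.placesTestFunction S Ξ₁ θ₁ (GLn.placesSplitting n K S q)) =
      fun q => Ξ₁ q.1 * θ₁ (q.2 : (AdelicGroupData.gl n K).Adelic) := by
    funext q
    rw [GLn.placesTestFunction_placesSplitting, mul_comm]
  have h2 : (fun q => GLn.placesTestFunction S Ξ₂ θ₂ (GLn.placesSplitting n K S q)) =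
      fun q => Ξ₂ q.1 * θ₂ (q.2 : (AdelicGroupData.gl n K).Adelic) := by
    funext q
    rw [GLn.placesTestFunction_placesSplitting, mul_comm]
  rw [h1, h2]
  exact mulConv_tensor μS μ' Ξ₁ Ξ₂
    (fun h : GLn.trivialAt n K S => θ₁ (h : (AdelicGroupData.gl n K).Adelic))
    (fun h => θ₂ (h : (AdelicGroupData.gl n K).Adelic)) p.1 p.2

/-- **Involution of a product test function on `GL_n(𝔸_K)`**:
`(Ξ ⊗ θ)^*(ι_S(a) h) = \overline{θ(h⁻¹)} · Ξ^*(a)`. [cite: Gelbart1975, §10 p. 153] -/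
theorem mulStar_placesTestFunction (Ξ : GLn.LocalPi n K S → ℂ) (θ : (AdelicGroupData.gl n K).Adelic → ℂ)
    (p : GLn.LocalPi n K S × GLn.trivialAt n K S) :
    mulStar (GLn.placesTestFunction S Ξ θ) (GLn.placesSplitting n K S p) =
      conj (θ ((p.2 : (AdelicGroupData.gl n K).Adelic)⁻¹)) * mulStar Ξ p.1 := by
  rw [mulStar_apply, ← map_inv, GLn.placesTestFunction_placesSplitting, map_mul, mulStar_apply,
    Prod.snd_inv, Prod.fst_inv, Subgroup.coe_inv]

/-- In particular, if `Ξ^* = Ξ` and `θ|^* = θ|` on `G^S` then `(Ξ ⊗ θ)^* = Ξ ⊗ θ` pointwise along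
the splitting. [cite: Gelbart1975, (10.11)] -/
theorem mulStar_placesTestFunction_of_selfAdjoint (Ξ : GLn.LocalPi n K S → ℂ) (hΞ : mulStar Ξ = Ξ)
    (θ : (AdelicGroupData.gl n K).Adelic → ℂ)
    (hθ : ∀ h : GLn.trivialAt n K S, conj (θ ((h : (AdelicGroupData.gl n K).Adelic)⁻¹)) =
      θ (h : (AdelicGroupData.gl n K).Adelic))
    (g : (AdelicGroupData.gl n K).Adelic) :
    mulStar (GLn.placesTestFunction S Ξ θ) g = GLn.placesTestFunction S Ξ θ g := by
  obtain ⟨p, rfl⟩ := (GLn.placesSplitting n K S).surjective g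
  rw [mulStar_placesTestFunction, hΞ, hθ, GLn.placesTestFunction_placesSplitting]

/-- `ι_w(l) ∈ G^S` for `w ∉ S`. [folklore] -/
theorem GLn.toAdelic_mem_trivialAt {w : HeightOneSpectrum (𝓞 K)} (hw : w ∉ S)
    (l : GL (Fin n) (w.adicCompletion K)) : GLn.toAdelic n K w l ∈ GLn.trivialAt n K S := by
  rw [GLn.mem_trivialAt_iff]
  intro v hv
  have hvw : w ≠ v := fun h => hw (h ▸ hv)
  exact GLn.toLocalAt_toAdelic_of_ne hvw l

/-- Left multiplication by an element of `G^S` does not change the `S`-components and multiplies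
the part away from `S`: `(k g)_S = g_S`, `s_S(k g) = k s_S(g)` for `k ∈ G^S`. [folklore] -/
theorem GLn.awayFromPlaces_mul_of_mem_trivialAt {k : (AdelicGroupData.gl n K).Adelic}
    (hk : k ∈ GLn.trivialAt n K S) (g : (AdelicGroupData.gl n K).Adelic) :
    GLn.awayFromPlaces n K S (k * g) = k * GLn.awayFromPlaces n K S g := by
  have hS : (fun v : S => GLn.toLocalAt n K (v : HeightOneSpectrum (𝓞 K)) (k * g)) =
      fun v : S => GLn.toLocalAt n K (v : HeightOneSpectrum (𝓞 K)) g := by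
    funext v
    rw [map_mul, (GLn.mem_trivialAt_iff.1 hk) _ v.2, one_mul]
  rw [GLn.awayFromPlaces, hS, GLn.awayFromPlaces, mul_assoc]

/-- **Translations at `w ∉ S` act on the `G^S`-factor**:
`Φ_{Ξ,θ}(ι_w(l)⁻¹ g) = Φ_{Ξ, θ(ι_w(l)⁻¹ ·)}(g)` — the left translate of a product test function by a
local element away from `S` is again a product test function with the same ramified factor
(Gelbart (1975), p. 153: `G^S` acts on the `f`-factor of `ξ_S ⊗ f`). [cite: Gelbart1975, §10 p. 153] -/
theorem GLn.placesTestFunction_toAdelic_inv_mul {w : HeightOneSpectrum (𝓞 K)} (hw : w ∉ S)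
    (l : GL (Fin n) (w.adicCompletion K)) (Ξ : GLn.LocalPi n K S → ℂ)
    (θ : (AdelicGroupData.gl n K).Adelic → ℂ) (g : (AdelicGroupData.gl n K).Adelic) :
    GLn.placesTestFunction S Ξ θ ((GLn.toAdelic n K w l)⁻¹ * g) =
      GLn.placesTestFunction S Ξ (fun x => θ ((GLn.toAdelic n K w l)⁻¹ * x)) g := by
  have hk : (GLn.toAdelic n K w l)⁻¹ ∈ GLn.trivialAt n K S :=
    Subgroup.inv_mem _ (GLn.toAdelic_mem_trivialAt hw l)
  rw [GLn.placesTestFunction_apply, GLn.placesTestFunction_apply, GLn.awayFromPlaces_mul_of_mem_trivialAt hk]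
  congr 2
  funext v
  rw [map_mul, (GLn.mem_trivialAt_iff.1 hk) _ v.2, one_mul]

/-- More generally, left translation by any `k ∈ G^S` acts on the `G^S`-factor. [folklore] -/
theorem GLn.placesTestFunction_mul_of_mem_trivialAt {k : (AdelicGroupData.gl n K).Adelic}
    (hk : k ∈ GLn.trivialAt n K S) (Ξ : GLn.LocalPi n K S → ℂ)
    (θ : (AdelicGroupData.gl n K).Adelic → ℂ) (g : (AdelicGroupData.gl n K).Adelic) :
    GLn.placesTestFunction S Ξ θ (k * g) = GLn.placesTestFunction S Ξ (fun x => θ (k * x)) g := by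
  rw [GLn.placesTestFunction_apply, GLn.placesTestFunction_apply, GLn.awayFromPlaces_mul_of_mem_trivialAt hk]
  congr 2
  funext v
  rw [map_mul, (GLn.mem_trivialAt_iff.1 hk) _ v.2, one_mul]

/-- **Every `F ∈ C_c(G^S)` is the restriction of some `θ ∈ C_c(GL_n(𝔸_K))`**: take
`θ(g) = β(g_S) F(s_S g)` with `β ∈ C_c(G_S)`, `β(1) = 1` (a bump on the locally compact group `G_S`;
`θ = Φ_{β, F ∘ s_S}` has compact support `⊆ ι_S(supp β) · supp F`). [folklore] -/
theorem GLn.exists_placesTestFunction_extension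
    [∀ v : HeightOneSpectrum (𝓞 K), T2Space (GL (Fin n) (v.adicCompletion K))]
    [∀ v : HeightOneSpectrum (𝓞 K), LocallyCompactSpace (GL (Fin n) (v.adicCompletion K))]
    (F : C_c(GLn.trivialAt n K S, ℂ)) :
    ∃ θ : C_c((AdelicGroupData.gl n K).Adelic, ℂ), ∀ h : GLn.trivialAt n K S,
      θ (h : (AdelicGroupData.gl n K).Adelic) = F h := by
  haveI : T2Space (AdelicGroupData.gl n K).Adelic := t2Space_gl n K
  -- a bump `β` on `G_S` with `β 1 = 1`
  obtain ⟨β, hβ1, -, hβs, -⟩ := exists_continuous_one_zero_of_isCompact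
    (isCompact_singleton (x := (1 : GLn.LocalPi n K S))) isClosed_empty (Set.disjoint_empty _)
  -- the extension `θ(g) = β(g_S) F(s_S g)`
  let θf : (AdelicGroupData.gl n K).Adelic → ℂ := fun g =>
    F ⟨GLn.awayFromPlaces n K S g, GLn.awayFromPlaces_mem_trivialAt g⟩ *
      (β (fun v => GLn.toLocalAt n K (v : HeightOneSpectrum (𝓞 K)) g) : ℂ)
  have hθc : Continuous θf :=
    (F.continuous.comp ((GLn.continuous_awayFromPlaces n K S).subtype_mk _)).mul
      (Complex.continuous_ofReal.comp (β.continuous.comp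
        (continuous_pi fun v : S => GLn.continuous_toLocalAt n K (v : HeightOneSpectrum (𝓞 K)))))
  have hθs : HasCompactSupport θf := by
    refine HasCompactSupport.intro
      ((hβs.isCompact.image (GLn.continuous_toAdelicPi n K S)).mul
        (F.hasCompactSupport.isCompact.image continuous_subtype_val)) fun g hg => ?_
    by_contra hne
    have h1 : F ⟨GLn.awayFromPlaces n K S g, GLn.awayFromPlaces_mem_trivialAt g⟩ ≠ 0 := fun h =>
      hne (by simp only [θf, h, zero_mul])
    have h2 : β (fun v => GLn.toLocalAt n K (v : HeightOneSpectrum (𝓞 K)) g) ≠ 0 := fun h =>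
      hne (by simp only [θf, h, Complex.ofReal_zero, mul_zero])
    exact hg ⟨_, ⟨_, subset_tsupport _ h2, rfl⟩, GLn.awayFromPlaces n K S g,
      ⟨⟨GLn.awayFromPlaces n K S g, GLn.awayFromPlaces_mem_trivialAt g⟩, subset_tsupport _ h1, rfl⟩,
      GLn.toAdelicPi_mul_awayFromPlaces g⟩
  refine ⟨⟨⟨θf, hθc⟩, hθs⟩, fun h => ?_⟩
  change F ⟨GLn.awayFromPlaces n K S (h : (AdelicGroupData.gl n K).Adelic), _⟩ *
    (β (fun v => GLn.toLocalAt n K (v : HeightOneSpectrum (𝓞 K)) (h : (AdelicGroupData.gl n K).Adelic)) : ℂ) = F h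
  have hh : (fun v : S => GLn.toLocalAt n K (v : HeightOneSpectrum (𝓞 K)) (h : (AdelicGroupData.gl n K).Adelic)) = 1 :=
    funext fun v => (GLn.mem_trivialAt_iff.1 h.2) _ v.2
  have hs : (⟨GLn.awayFromPlaces n K S (h : (AdelicGroupData.gl n K).Adelic),
      GLn.awayFromPlaces_mem_trivialAt (h : (AdelicGroupData.gl n K).Adelic)⟩ : GLn.trivialAt n K S) = h :=
    Subtype.ext (GLn.awayFromPlaces_eq_self_of_mem h.2)
  rw [hh, hs]
  have : (β : GLn.LocalPi n K S → ℝ) 1 = 1 := hβ1 (Set.mem_singleton 1)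
  rw [this, Complex.ofReal_one, mul_one]

end GLn

end Literature.NumberTheory.Automorphic
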